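import Literature.AlgebraicGeometry.Resolution.ExcellentRingsProofs
import Literature.AlgebraicGeometry.Resolution.FieldsJ2
import Literature.AlgebraicGeometry.Resolution.WeakJacobianMizutaniProof
import Literature.RingTheory.KrullDimension.AffineCatenary
import HarnessLib

/-!
# Excellent rings: finite type algebras over a field (Stacks 07QW (1), (5); proofs)

Topic: `Literature/AlgebraicGeometry/Resolution`. Companion of `ExcellentRings.lean` (proofs only,
no new notions, no new named facts). The named fact `Stacks07QW_field` there reads: *every finitely
generated algebra `A` over a field `k` is excellent*, i.e. (Matsumura §32, p. 260, Definition)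
(1) universally catenary, (2) a G-ring, (3) J-2. The Stacks Project proves Proposition 07QW by
"See Propositions 07PX and 07PJ to see that these rings are G-rings and have J-2. Any
Cohen–Macaulay ring is universally catenary, see Algebra, Lemma 00NM. In particular fields …
are universally catenary." This file PROVES parts (1) and (3) and reduces the fact to part (2),
which is the named fact `Matsumura1987_32_6_cor` of `ExcellentRings.lean` (Matsumura, Cor. of
Thm. 32.6: finitely generated algebras over a field are G-rings; in the tree it is further
reduced to `Matsumura1987_32_polynomial`, `ExcellentRingsProofs.lean`, and to Mizutani's
Thm. 32.6, `WeakJacobianPolynomial.lean`):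

* `Stacks07QW_field_of_matsumura1987_32_6_cor : Matsumura1987_32_6_cor → Stacks07QW_field` and
  `stacks07QW_field_iff_matsumura1987_32_6_cor` (the converse being
  `Stacks07QW_field.matsumura1987_32_6_cor`), `Stacks07QW_field_of_matsumura1987_32_polynomial`.
* `isExcellentRing_of_field` — **fields are excellent** (07QW (1)), PROVED outright.
* `Stacks07QW_field_holds` — the DISCHARGE of `Stacks07QW_field` (07QW (5) over (1)): part (2)
  is `Matsumura1987_32_6_cor_holds` (`WeakJacobianMizutaniProof.lean`: Matsumura, Cor. of
  Thm. 32.6, PROVED there through Mizutani's Thm. 32.6 and Thm. 32.5), fed to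
  `Stacks07QW_field_of_matsumura1987_32_6_cor`.

## (1) Finitely generated algebras over a field are universally catenary

Mathlib (this pin) has no Cohen–Macaulay rings, so instead of Stacks 00NM we use the dimension
theory of affine domains already in the tree (`Literature.RingTheory.KrullDimension.AffineCatenary`:
for a domain `A` of finite type over a field and a prime `P` of height one,
`dim A⧸P + 1 = dim A`, Matsumura Thm. 5.6 / Stacks 00OS "every maximal chain of primes has length
equal to the dimension"). For `B` of finite type over `k`, `δ(𝔭) = dim B⧸𝔭 ∈ ℕ` is a RANK
FUNCTION on `Spec B`: if `𝔭 ⋖ 𝔮` (no prime strictly between) then `𝔮/𝔭` has height one in the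
affine domain `B⧸𝔭`, so `δ(𝔭) = δ(𝔮) + 1` (`ringKrullDim_quotient_add_one_of_covBy`). Pure order
theory then gives catenarity in Matsumura's sense (§5 p. 31, `IsCatenaryRing`): along a saturated
chain `δ` drops by one at each step, so every saturated chain from `𝔭` to `𝔮` has length
`δ(𝔭) - δ(𝔮)` (`rank_head_eq_rank_add`), and saturated chains exist between any `𝔭 ≤ 𝔮` of a poset
of finite Krull dimension (`exists_isSaturated_ltSeries_of_krullDim_lt_top`: a chain of maximal
length inside the interval `[𝔭, 𝔮]`, maximal by a height count). Hence
`isCatenaryRing_of_finiteType_field`, and, finite type over finite type being finite type,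
`isUniversallyCatenaryRing_of_finiteType_field` (Matsumura Thm. 17.9 for quotients of polynomial
rings over a field; Stacks 07QW proof, first sentence on universal catenarity).

## (3) Finitely generated algebras over a field are J-2

This is `isOpen_regularLocus_of_finiteType_field` (`FieldsJ2.lean`, Matsumura Cor. to Thm. 30.5,
PROVED there through Nagata's criterion) applied to finite type algebras over the given one; the
same five lines as `isJ2Ring_of_finiteType_field` of `CanonicalResolutionProofs.lean`, inlined here
to keep the imports of this file small.

## Sources

* The Stacks Project, Tag 07QW (Proposition "ubiquity-excellent") with its proof; Tags 00NI, 00NL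
  (catenary, universally catenary), 00OS (maximal chains in affine domains), 07QS–07QT.
  [StacksProject]
* H. Matsumura, *Commutative Ring Theory*, CUP 1986: §5 p. 31 (catenary), Thm. 5.6 (dimension of
  affine domains), §15 p. 116 (universally catenary), Thm. 17.9 p. 137 ("Any quotient of a CM
  ring is universally catenary"), §30 Cor. to Thm. 30.5, §32 p. 260 (Definition of excellence;
  Cor. of Thm. 32.6). [Matsumura1987]
-/

noncomputable section

open Order

namespace Literature.AlgebraicGeometry.Resolution

universe u

/-! ## Order theory: saturated chains under a rank function -/

section RankFunction

variable {α : Type*} [PartialOrder α]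

/-- **A rank function drops by the index along a saturated chain**: if `δ a = δ b + 1` whenever
`a ⋖ b`, then along a chain whose consecutive terms are covers, `δ (head) = δ (sᵢ) + i`.
[folklore] -/
theorem rank_head_eq_rank_add (δ : α → ℕ) (hδ : ∀ {a b : α}, a ⋖ b → δ a = δ b + 1)
    (s : LTSeries α) (hs : ∀ i : Fin s.length, s i.castSucc ⋖ s i.succ) :
    ∀ i : Fin (s.length + 1), δ s.head = δ (s i) + i := by
  refine Fin.induction ?_ ?_
  · simp only [RelSeries.apply_zero, Fin.val_zero, add_zero]
  · intro i ih
    have h := hδ (hs i)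
    rw [Fin.val_succ, ih, h, Fin.val_castSucc]
    omega

/-- Consequently a saturated chain has length `δ (head) - δ (last)`; precisely
`δ (head) = δ (last) + length`. [folklore] -/
theorem rank_head_eq_rank_last_add_length (δ : α → ℕ) (hδ : ∀ {a b : α}, a ⋖ b → δ a = δ b + 1)
    (s : LTSeries α) (hs : ∀ i : Fin s.length, s i.castSucc ⋖ s i.succ) :
    δ s.head = δ s.last + s.length := by
  have h := rank_head_eq_rank_add δ hδ s hs (Fin.last s.length)
  rwa [RelSeries.apply_last, Fin.val_last] at h

/-- **Saturated chains exist in posets of finite Krull dimension**: if `krullDim α < ⊤` and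
`p ≤ q`, there is a chain `p = s₀ ⋖ s₁ ⋖ ⋯ ⋖ sₙ = q` of covers. Proof: inside the interval
`[p, q]` take a chain ending at `q` of length the (finite) height of `q` there; it must start at
`p`, and its `i`-th term has height exactly `i`, so nothing fits strictly between consecutive
terms. [folklore] -/
theorem exists_isSaturated_ltSeries_of_krullDim_lt_top (hfin : krullDim α < ⊤) {p q : α}
    (hpq : p ≤ q) :
    ∃ s : LTSeries α, s.head = p ∧ s.last = q ∧ ∀ i : Fin s.length, s i.castSucc ⋖ s i.succ := by
  let qI : Set.Icc p q := ⟨q, hpq, le_rfl⟩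
  let pI : Set.Icc p q := ⟨p, le_rfl, hpq⟩
  have hIα : krullDim (Set.Icc p q) ≤ krullDim α :=
    krullDim_le_of_strictMono (fun x : Set.Icc p q => (x : α)) (fun _ _ h => h)
  have htop : height qI ≠ ⊤ := by
    intro h
    have h1 : (height qI : WithBot ℕ∞) ≤ krullDim α := (height_le_krullDim qI).trans hIα
    rw [h] at h1
    exact absurd (lt_of_le_of_lt h1 hfin) (lt_irrefl _)
  obtain ⟨m, hm⟩ := ENat.ne_top_iff_exists.mp htop
  obtain ⟨c, hclast, hclen⟩ := exists_series_of_height_eq_coe qI hm.symm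
  have hlenh : c.length = height c.last := by rw [hclast, ← hm, hclen]
  -- the chain starts at `p`
  have hchead : c.head = pI := by
    by_contra hne
    have hlt : pI < c.head := lt_of_le_of_ne c.head.2.1 (Ne.symm hne)
    have h1 := length_le_height_last (p := c.cons pI hlt)
    rw [RelSeries.last_cons, hclast, ← hm, RelSeries.cons_length, hclen] at h1
    have h2 : m + 1 ≤ m := by exact_mod_cast h1
    omega
  -- consecutive terms are covers in the interval
  have hcovI : ∀ i : Fin c.length, c i.castSucc ⋖ c i.succ := fun i => by
    have h1 : height (c i.castSucc) = ((i : ℕ) : ℕ∞) := by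
      rw [height_eq_index_of_length_eq_height_last hlenh]; simp
    have h2 : height (c i.succ) ≤ ((i : ℕ) : ℕ∞) + 1 := by
      rw [height_eq_index_of_length_eq_height_last hlenh]; simp
    exact ⟨c.strictMono Fin.castSucc_lt_succ, fun x hx hx' =>
      Literature.RingTheory.KrullDimension.not_lt_of_lt_of_height_le h1 h2 hx hx'⟩
  -- and hence in `α`
  refine ⟨c.map (fun x : Set.Icc p q => (x : α)) (fun _ _ h => h), ?_, ?_, fun i => ?_⟩
  · rw [LTSeries.head_map, hchead]
  · rw [LTSeries.last_map, hclast]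
  · have hc := hcovI i
    refine ⟨hc.1, fun x hx hx' => ?_⟩
    have hxI : x ∈ Set.Icc p q := ⟨(c i.castSucc).2.1.trans hx.le, hx'.le.trans (c i.succ).2.2⟩
    exact hc.2 (c := ⟨x, hxI⟩) hx hx'

end RankFunction

/-- **Catenarity from a rank function**: a ring of finite Krull dimension whose spectrum carries
`δ : Spec A → ℕ` with `δ 𝔭 = δ 𝔮 + 1` whenever `𝔭 ⋖ 𝔮` is catenary in Matsumura's sense
(`IsCatenaryRing`: saturated chains exist between any `𝔭 ≤ 𝔮` and all have the same length,
here `δ 𝔭 - δ 𝔮`). [folklore] -/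
theorem isCatenaryRing_of_rank {A : Type u} [CommRing A] (hfin : ringKrullDim A < ⊤)
    (δ : PrimeSpectrum A → ℕ) (hδ : ∀ {P Q : PrimeSpectrum A}, P ⋖ Q → δ P = δ Q + 1) :
    IsCatenaryRing A := by
  intro p q hpq
  obtain ⟨s, hsh, hsl, hss⟩ := exists_isSaturated_ltSeries_of_krullDim_lt_top hfin hpq
  refine ⟨δ p - δ q, ⟨s, hsh, hsl, hss, ?_⟩, fun t hth htl hts => ?_⟩
  · have h := rank_head_eq_rank_last_add_length δ hδ s hss
    rw [hsh, hsl] at h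
    omega
  · have h := rank_head_eq_rank_last_add_length δ hδ t hts
    rw [hth, htl] at h
    omega

/-! ## The rank function `𝔭 ↦ dim B⧸𝔭` on the spectrum of a finite type algebra over a field -/

/-- If `𝔭 ⋖ 𝔮` in `Spec B` (no prime strictly between), the image of `𝔮` in `B ⧸ 𝔭` is a prime of
height one. [folklore] -/
theorem height_map_quotientMk_eq_one_of_covBy {B : Type u} [CommRing B] {P Q : PrimeSpectrum B}
    (h : P ⋖ Q) : (Q.asIdeal.map (Ideal.Quotient.mk P.asIdeal)).height = 1 := by
  have hle : P.asIdeal ≤ Q.asIdeal := h.le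
  haveI hP' : (Q.asIdeal.map (Ideal.Quotient.mk P.asIdeal)).IsPrime :=
    Ideal.isPrime_map_quotientMk_of_isPrime hle
  have hQmem : Q ∈ PrimeSpectrum.zeroLocus (P.asIdeal : Set B) := by
    rw [PrimeSpectrum.mem_zeroLocus]; exact hle
  have hPmem : P ∈ PrimeSpectrum.zeroLocus (P.asIdeal : Set B) := by
    rw [PrimeSpectrum.mem_zeroLocus]
  set e := Ideal.primeSpectrumQuotientOrderIsoZeroLocus P.asIdeal with he
  have heQ : e ⟨Q.asIdeal.map (Ideal.Quotient.mk P.asIdeal), hP'⟩ = ⟨Q, hQmem⟩ := by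
    apply Subtype.ext
    apply PrimeSpectrum.ext
    exact Ideal.comap_map_mk hle
  rw [Literature.RingTheory.KrullDimension.ideal_height_eq_orderHeight
    (Q.asIdeal.map (Ideal.Quotient.mk P.asIdeal)), ← Order.height_orderIso e, heQ]
  apply le_antisymm
  · rw [← Nat.cast_one, Order.height_le_coe_iff]
    intro y hy
    have hPy : P ≤ (y : PrimeSpectrum B) := by
      have hy2 := y.2
      rw [PrimeSpectrum.mem_zeroLocus] at hy2
      exact hy2
    have hyP : (y : PrimeSpectrum B) = P := by
      rcases hPy.eq_or_lt with h1 | h1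
      · exact h1.symm
      · exact absurd hy (h.2 h1)
    have hy0 : Order.height y = 0 := by
      rw [Order.height_eq_zero]
      intro z hz
      have hz2 := z.2
      rw [PrimeSpectrum.mem_zeroLocus] at hz2
      show (y : PrimeSpectrum B) ≤ z
      rw [hyP]
      exact hz2
    rw [hy0, Nat.cast_one]
    exact zero_lt_one
  · have hlt : (⟨P, hPmem⟩ : PrimeSpectrum.zeroLocus (P.asIdeal : Set B)) < ⟨Q, hQmem⟩ := h.1
    exact le_trans (by simp) (Order.height_add_one_le hlt)

/-- **The rank drops by one across a cover**: for `B` of finite type over a field `k` and primes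
`𝔭 ⋖ 𝔮` of `B` with no prime strictly between, `dim B⧸𝔮 + 1 = dim B⧸𝔭` — the height-one case of
the dimension formula in the affine domain `B⧸𝔭` (Matsumura Thm. 5.6; Stacks 00OS).
[cite: Matsumura1987, Thm 5.6] -/
theorem ringKrullDim_quotient_add_one_of_covBy (k : Type u) {B : Type u} [Field k] [CommRing B]
    [Algebra k B] [Algebra.FiniteType k B] {P Q : PrimeSpectrum B} (h : P ⋖ Q) :
    ringKrullDim (B ⧸ Q.asIdeal) + 1 = ringKrullDim (B ⧸ P.asIdeal) := by
  have hle : P.asIdeal ≤ Q.asIdeal := h.le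
  haveI : IsDomain (B ⧸ P.asIdeal) := Ideal.Quotient.isDomain _
  haveI hP' : (Q.asIdeal.map (Ideal.Quotient.mk P.asIdeal)).IsPrime :=
    Ideal.isPrime_map_quotientMk_of_isPrime hle
  have h1 := Literature.RingTheory.KrullDimension.ringKrullDim_quotient_add_one_of_height_eq_one k
    (Q.asIdeal.map (Ideal.Quotient.mk P.asIdeal)) (height_map_quotientMk_eq_one_of_covBy h)
  rwa [ringKrullDim_eq_of_ringEquiv (DoubleQuot.quotQuotEquivQuotOfLE hle)] at h1

/-- A finite type algebra over a field has finite Krull dimension (it is a quotient of some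
`k[X₁, …, Xₙ]`, of dimension `n`). [folklore] -/
theorem ringKrullDim_lt_top_of_finiteType_field (k B : Type u) [Field k] [CommRing B]
    [Algebra k B] [Algebra.FiniteType k B] : ringKrullDim B < ⊤ := by
  obtain ⟨n, f, hf⟩ := Algebra.FiniteType.iff_quotient_mvPolynomial''.mp ‹Algebra.FiniteType k B›
  have h1 : ringKrullDim B ≤ ringKrullDim (MvPolynomial (Fin n) k) :=
    ringKrullDim_le_of_surjective f.toRingHom hf
  rw [MvPolynomial.ringKrullDim_of_isNoetherianRing, ringKrullDim_eq_zero_of_field,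
    Nat.card_eq_fintype_card, Fintype.card_fin, zero_add] at h1
  exact lt_of_le_of_lt h1 (WithBot.coe_lt_coe.mpr (ENat.coe_lt_top n))

/-- On the spectrum of a finite type algebra `B` over a field, `𝔭 ↦ dim B⧸𝔭` is a natural number
(`dim = trdeg` for the affine domain `B⧸𝔭`, Matsumura Thm. 5.6). [cite: Matsumura1987, Thm 5.6] -/
theorem exists_ringKrullDim_quotient_eq_nat (k : Type u) {B : Type u} [Field k] [CommRing B]
    [Algebra k B] [Algebra.FiniteType k B] (P : PrimeSpectrum B) :
    ∃ n : ℕ, ringKrullDim (B ⧸ P.asIdeal) = n := by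
  haveI : IsDomain (B ⧸ P.asIdeal) := Ideal.Quotient.isDomain _
  obtain ⟨n, hn, -⟩ :=
    Literature.RingTheory.KrullDimension.exists_ringKrullDim_eq_and_trdeg_eq k (B ⧸ P.asIdeal)
  exact ⟨n, hn⟩

/-! ## (1) Universal catenarity -/

/-- **Finitely generated algebras over a field are catenary** (Matsumura §5 p. 31 / Thm. 17.9 for
quotients of `k[X₁, …, Xₙ]`; Stacks 00OS): for primes `𝔭 ⊆ 𝔮` saturated chains from `𝔭` to `𝔮`
exist and all have length `dim B⧸𝔭 - dim B⧸𝔮`. [cite: Matsumura1987, Thm 17.9] -/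
theorem isCatenaryRing_of_finiteType_field (k B : Type u) [Field k] [CommRing B] [Algebra k B]
    [Algebra.FiniteType k B] : IsCatenaryRing B := by
  choose δ hδ using exists_ringKrullDim_quotient_eq_nat k (B := B)
  refine isCatenaryRing_of_rank (ringKrullDim_lt_top_of_finiteType_field k B) δ ?_
  intro P Q h
  have h1 := ringKrullDim_quotient_add_one_of_covBy k h
  rw [hδ P, hδ Q] at h1
  have h2 : δ Q + 1 = δ P := by exact_mod_cast h1
  omega

/-- **Finitely generated algebras over a field are universally catenary** (Matsumura Thm. 17.9
with Thm. 17.7: quotients of the Cohen–Macaulay rings `k[X₁, …, Xₙ]`; Stacks 07QW, proof: "Any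
Cohen–Macaulay ring is universally catenary … In particular fields … are universally
catenary"): Noetherian, and a finite type algebra over a finite type `k`-algebra is of finite type
over `k`, hence catenary. [cite: Matsumura1987, Thm 17.9] -/
theorem isUniversallyCatenaryRing_of_finiteType_field (k A : Type u) [Field k] [CommRing A]
    [Algebra k A] [Algebra.FiniteType k A] : IsUniversallyCatenaryRing A := by
  refine ⟨Algebra.FiniteType.isNoetherianRing k A, fun B _ _ hB => ?_⟩
  letI : Algebra k B := ((algebraMap A B).comp (algebraMap k A)).toAlgebra
  haveI : IsScalarTower k A B := IsScalarTower.of_algebraMap_eq fun _ => rfl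
  haveI : Algebra.FiniteType k B := Algebra.FiniteType.trans ‹Algebra.FiniteType k A› hB
  exact isCatenaryRing_of_finiteType_field k B

/-- **Fields are universally catenary** (Stacks 07QW proof; Matsumura Thm. 17.9).
[cite: StacksProject, Tag 07QW] -/
theorem isUniversallyCatenaryRing_of_field (k : Type u) [Field k] : IsUniversallyCatenaryRing k :=
  isUniversallyCatenaryRing_of_finiteType_field k k

/-! ## (3) J-2, and the assembly of `Stacks07QW_field` from `Matsumura1987_32_6_cor` -/

/-- **Fields are excellent** — Stacks 07QW (1), PROVED: universally catenary
(`isUniversallyCatenaryRing_of_field`), a G-ring (`isGRing_of_field`, Matsumura §32 p. 257) and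
J-2 (`isJ2Ring_of_field`, Matsumura Cor. to Thm. 30.5). [cite: StacksProject, Tag 07QW] -/
theorem isExcellentRing_of_field (k : Type u) [Field k] : IsExcellentRing k :=
  ⟨isUniversallyCatenaryRing_of_field k, isGRing_of_field k, isJ2Ring_of_field k⟩

/-- **Stacks 07QW (5) over (1), reduced to the G-ring property**: if finitely generated algebras
over fields are G-rings (`Matsumura1987_32_6_cor`, Matsumura Cor. of Thm. 32.6), then they are
excellent — universally catenary by `isUniversallyCatenaryRing_of_finiteType_field`, J-2 because
a finite type algebra over them is of finite type over the field and so has open regular locus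
(`isOpen_regularLocus_of_finiteType_field`, Matsumura Cor. to Thm. 30.5).
[cite: StacksProject, Tag 07QW] -/
theorem Stacks07QW_field_of_matsumura1987_32_6_cor (hG : Matsumura1987_32_6_cor.{u}) :
    Stacks07QW_field.{u} := by
  intro k A _ _ _ hA
  haveI := hA
  refine ⟨isUniversallyCatenaryRing_of_finiteType_field k A, hG k A hA,
    Algebra.FiniteType.isNoetherianRing k A, fun C _ _ hC => ?_⟩
  letI : Algebra k C := ((algebraMap A C).comp (algebraMap k A)).toAlgebra
  haveI : IsScalarTower k A C := IsScalarTower.of_algebraMap_eq fun _ => rfl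
  haveI : Algebra.FiniteType k C := Algebra.FiniteType.trans hA hC
  exact isOpen_regularLocus_of_finiteType_field k C

/-- `Stacks07QW_field` is EQUIVALENT to its G-ring component `Matsumura1987_32_6_cor`, the other
two components being theorems. [cite: StacksProject, Tag 07QW] -/
theorem stacks07QW_field_iff_matsumura1987_32_6_cor :
    Stacks07QW_field.{u} ↔ Matsumura1987_32_6_cor.{u} :=
  ⟨Stacks07QW_field.matsumura1987_32_6_cor, Stacks07QW_field_of_matsumura1987_32_6_cor⟩

/-- `Stacks07QW_field` from the single leaf `Matsumura1987_32_polynomial` (`k[X₁, …, Xₙ]` is a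
G-ring; Matsumura, proof of Cor. of Thm. 32.6), through `Matsumura1987_32_6_cor_of_polynomial`.
[cite: Matsumura1987, §32 p. 260, Cor. of Thm. 32.6] -/
theorem Stacks07QW_field_of_matsumura1987_32_polynomial (hp : Matsumura1987_32_polynomial.{u}) :
    Stacks07QW_field.{u} :=
  Stacks07QW_field_of_matsumura1987_32_6_cor (Matsumura1987_32_6_cor_of_polynomial hp)

/-- DISCHARGE of the named fact `Stacks07QW_field` (`ExcellentRings.lean`) — **Stacks 07QW**:
"The following types of rings are excellent: (1) fields, … (5) finite type ring extensions of
any of the above", i.e. every finitely generated algebra over a field is excellent (universally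
catenary, a G-ring, J-2; Matsumura §32 p. 260, Definition). Along the printed proof ("See
Propositions 07PX and 07PJ to see that these rings are G-rings and have J-2. Any Cohen–Macaulay
ring is universally catenary … In particular fields … are universally catenary"): universally
catenary by `isUniversallyCatenaryRing_of_finiteType_field`, J-2 by
`isOpen_regularLocus_of_finiteType_field` (Matsumura Cor. to Thm. 30.5) — both assembled in
`Stacks07QW_field_of_matsumura1987_32_6_cor` — and a G-ring by `Matsumura1987_32_6_cor_holds`
(Matsumura, Cor. of Thm. 32.6 p. 260, proved in `WeakJacobianMizutaniProof.lean` through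
Mizutani's Thm. 32.6). [cite: StacksProject, Tag 07QW] -/
theorem Stacks07QW_field_holds : Stacks07QW_field.{u} :=
  Stacks07QW_field_of_matsumura1987_32_6_cor Matsumura1987_32_6_cor_holds

/-- **Finitely generated algebras over a field are excellent** — `Stacks07QW_field_holds` in
applied form. [cite: StacksProject, Tag 07QW] -/
theorem isExcellentRing_of_finiteType_field (k A : Type u) [Field k] [CommRing A] [Algebra k A]
    [Algebra.FiniteType k A] : IsExcellentRing A :=
  Stacks07QW_field_holds k A ‹_›

/-- **Finitely generated algebras over a field are quasi-excellent** (G-ring and J-2), from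
`Stacks07QW_field_holds`. [cite: StacksProject, Tag 07QW] -/
theorem isQuasiExcellentRing_of_finiteType_field (k A : Type u) [Field k] [CommRing A]
    [Algebra k A] [Algebra.FiniteType k A] : IsQuasiExcellentRing A :=
  Stacks07QW_field_holds.isQuasiExcellentRing k A

end Literature.AlgebraicGeometry.Resolution

end
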